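import Summits.AtomisticToContinuum.FouriersLaw.Theorems.PhononMeanFreePathIncoherentBoundedMixedKubo
import Summits.AtomisticToContinuum.FouriersLaw.Theorems.OddSectorIrreversibilityCorrectorTheoryExistence
import Summits.AtomisticToContinuum.FouriersLaw.Theorems.BoundaryKubo.Negative.Reflection
import Summits.AtomisticToContinuum.FouriersLaw.Theorems.PhononMeanFreePathIncoherentBoundedCoherentLandauer

/-!
# `PhononMeanFreePath.IncoherentBounded` — the current–current Green–Kubo form of the cross kernel and `∫₀^∞ C_N ≥ 0`

Helper file for item `stmt-AtomisticToContinuum-11815` (support `IncoherentBounded`, route `PhononMeanFreePath`,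
sub-problem `FouriersLaw`). For the `(N+1)`-site pinned anharmonic chain between two Langevin baths at the same
temperature `T` (`μ₀ = gibbsMeasure (N+1) T`, `K_s = transitionKernel (N+1) T T s`, CONSTRUCTED), the total current
`J = Σ_i j_i` (`OscillatorChain.bondCurrent`; the last index carries no bond), `θ₀ = p₀² - T`, and the item's cross kernel
`C_N(s) = ∫ θ₀ · K_s θ_N dμ₀`:

* `integral_corr_totalCurrent_eq_sum` — linearity: `∫₀^∞ ⟨f, K_s J⟩ = Σ_{i<N} ∫₀^∞ ⟨f, K_s j_i⟩` for a centred `f` of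
  exponential class;
* `integral_kinCorr_totalCurrent` — **`∫₀^∞ ⟨θ₀, K_s J⟩ ds = N γ ∫₀^∞ C_N`** (`…MixedKubo.integral_kinCorr_current_near`
  summed over the `N` bonds);
* `integral_totalCorr_current_eq`, `integral_totalCorr_totalCurrent` — the mixed identity with `f = J` (centred, odd,
  `⟨J, E_{≤i}⟩_{μ₀} = 0`) gives `∫₀^∞ ⟨J, K_s j_i⟩ = -γ ∫₀^∞ ⟨J, K_s θ₀⟩`, time reversal (`J∘Θ = -J`, `θ₀∘Θ = θ₀`,
  `HonestZwanzig.pinnedChain_integral_mul_act_flip`) gives `∫₀^∞ ⟨J, K_s θ₀⟩ = -∫₀^∞ ⟨θ₀, K_s J⟩`, whence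
  **`∫₀^∞ ⟨J, K_s J⟩_{μ₀} ds = γ² N² ∫₀^∞ C_N`** — the current–current Green–Kubo integral of the open chain IS the cross-form
  Kubo value of `BoundaryKubo` (Kundu–Dhar–Narayan's `G = (k_B T²)⁻¹ ∫⟨j̄ j̄⟩`, `j̄ = J/N`, at the level of the constructed
  equilibrium kernels, no steady state and no linear response needed);
* `integral_CN_nonneg`, **`conductance_nonneg`** — Green–Kubo positivity for `J` (`greenKubo_autocorr_nonneg`) gives
  `∫₀^∞ C_N ≥ 0` for EVERY `N`: with `conductance_le_half`, **`0 ≤ (γ²/T²)∫₀^∞ C_N ≤ γ/2` uniformly in `N`**;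
* `seq_ge_neg_linear`, `abs_seq_le_linear` — for the item: `-γN ≤ a_N ≤ γN/2`, `|a_N| ≤ γN` for every `N` (the complete
  two-sided `N`-uniform information available; `IncoherentBounded` asks for `|a_N| = O(1)`, the open conductance bound).

No definitions; nothing here closes an item.
-/

noncomputable section

open MeasureTheory ProbabilityTheory Filter Topology Set
open scoped NNReal ENNReal
open Literature.MathematicalPhysics.KineticTheory.HeatConduction
open Literature.MathematicalPhysics.KineticTheory Literature.Probability.Process OscillatorChain
open Literature.MathematicalPhysics.KineticTheory.HeatConduction.HardTether (leftEnergy blockWeight)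
open Summit.AtomisticToContinuum.FouriersLaw.Theorems.SubdiffusiveBondHeat
open Summit.AtomisticToContinuum.FouriersLaw.Theorems.BoundaryKubo.GibbsTtcf
  (contDiff_leftEnergy leftEnergy_nonneg leftEnergy_le_hamiltonian blockWeight_nonneg_le_one)
open Summit.AtomisticToContinuum.FouriersLaw.Theorems.OddSectorIrreversibility.Corrector
  (continuous_totalBondCurrent abs_totalBondCurrent_le_exp totalBondCurrent_neg_momentum
    integral_mul_gibbsDensity_eq_zero_of_odd integral_totalBondCurrent_gibbsMeasure)
open Summit.AtomisticToContinuum.FouriersLaw.Theorems.BoundaryKubo.Negative.Reflection (bondCurrent_eq_zero_of_not_lt)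
open Summit.AtomisticToContinuum.FouriersLaw.Theorems.HonestZwanzig (pinnedChain_integral_mul_act_flip)
open Summit.AtomisticToContinuum.FouriersLaw.Theorems.LightConeBondHeat (pinnedChain_abs_bondCurrent_le_exp)

namespace Summit.AtomisticToContinuum.FouriersLaw.Theorems.IncoherentBounded

section Current

variable {ω₂ lam β γ : ℝ} (hω : 0 < ω₂) (hl : 0 ≤ lam) (hβ : 0 < β) (hγ : 0 < γ) {T : ℝ} (hT : 0 < T) {N : ℕ}
include hω hl hβ hγ hT

/-! ### Linearity in the current slot -/

/-- **Linearity in the second slot**: for a centred `f` of exponential class,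
`∫₀^∞ ⟨f, K_s J⟩ ds = Σ_{i<N} ∫₀^∞ ⟨f, K_s j_i⟩ ds` (`J = Σ_i j_i`; the last index carries no bond, all kernels are in
`L¹(0,∞)`). [folklore] -/
theorem integral_corr_totalCurrent_eq_sum {f : PhaseSpace (N + 1) → ℝ} (hf : Continuous f) {Cf : ℝ}
    (hfb : ∀ y, |f y| ≤ Cf * Real.exp (1 / (4 * T) * (pinnedChain ω₂ lam β γ).hamiltonian (N + 1) y))
    (hf0 : ∫ z, f z ∂((pinnedChain ω₂ lam β γ).gibbsMeasure (N + 1) T) = 0) :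
    ∫ u in Ioi (0 : ℝ), ∫ z, f z * (∫ y, (∑ i : Fin (N + 1), (pinnedChain ω₂ lam β γ).bondCurrent (N + 1) i y)
        ∂((pinnedChain ω₂ lam β γ).transitionKernel (N + 1) T T u.toNNReal z)) ∂((pinnedChain ω₂ lam β γ).gibbsMeasure (N + 1) T) =
      ∑ i : Fin N, ∫ u in Ioi (0 : ℝ), ∫ z, f z * (∫ y, (pinnedChain ω₂ lam β γ).bondCurrent (N + 1) i.castSucc y
        ∂((pinnedChain ω₂ lam β γ).transitionKernel (N + 1) T T u.toNNReal z)) ∂((pinnedChain ω₂ lam β γ).gibbsMeasure (N + 1) T) := by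
  set P := pinnedChain ω₂ lam β γ with hP
  set μ := P.gibbsMeasure (N + 1) T with hμ
  haveI : IsProbabilityMeasure μ := pinnedChain_isProbabilityMeasure_gibbsMeasure hω hl hβ.le γ (N + 1) hT
  have hN : 0 < N + 1 := Nat.succ_pos N
  have hϑ0 : (0 : ℝ) < 1 / (4 * T) := by positivity
  have hinv : ∀ s : ℝ≥0, μ.bind (P.transitionKernel (N + 1) T T s) = μ := fun s =>
    pinnedChain_gibbsMeasure_bind_transitionKernel hω hl hβ.le hγ.le hN hT s
  have hf2 : Integrable (fun y => f y ^ 2) μ := integrable_sq_of_abs_le_exp hω hl hβ hT hf hfb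
  have hlast : ∀ y, P.bondCurrent (N + 1) (Fin.last N) y = 0 := fun y =>
    bondCurrent_eq_zero_of_not_lt P (by simp [Fin.val_last]) y
  -- the pointwise identity `⟨f, K_u J⟩ = Σ_{i<N} ⟨f, K_u j_i⟩`
  have hpt : ∀ u : ℝ, ∫ z, f z * (∫ y, (∑ i : Fin (N + 1), P.bondCurrent (N + 1) i y) ∂(P.transitionKernel (N + 1) T T u.toNNReal z)) ∂μ =
      ∑ i : Fin N, ∫ z, f z * (∫ y, P.bondCurrent (N + 1) i.castSucc y ∂(P.transitionKernel (N + 1) T T u.toNNReal z)) ∂μ := by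
    intro u
    have hin : ∀ z, (∫ y, (∑ i : Fin (N + 1), P.bondCurrent (N + 1) i y) ∂(P.transitionKernel (N + 1) T T u.toNNReal z)) =
        ∑ i : Fin N, ∫ y, P.bondCurrent (N + 1) i.castSucc y ∂(P.transitionKernel (N + 1) T T u.toNNReal z) := by
      intro z
      rw [integral_finsetSum _ (fun i _ => integrable_bondCurrent_transitionKernel hω hl hβ hT hγ.le i _ z),
        Fin.sum_univ_castSucc]
      have h0 : ∫ y, P.bondCurrent (N + 1) (Fin.last N) y ∂(P.transitionKernel (N + 1) T T u.toNNReal z) = 0 :=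
        (integral_congr_ae (Eventually.of_forall (hlast))).trans (integral_zero _ _)
      rw [h0, add_zero]
    simp_rw [hin, Finset.mul_sum]
    have hint : ∀ i ∈ (Finset.univ : Finset (Fin N)), Integrable (fun z => f z *
        ∫ y, P.bondCurrent (N + 1) i.castSucc y ∂(P.transitionKernel (N + 1) T T u.toNNReal z)) μ := fun i _ =>
      (pinnedChain_integrable_mul_act_of_invariant hω hl hβ.le hγ.le (N + 1) T T μ u.toNNReal (hinv _)
        hf.measurable (pinnedChain_continuous_bondCurrent ω₂ lam β γ (N + 1) _).measurable hf2
        (pinnedChain_integrable_sq_bondCurrent hω hl hβ.le γ (N + 1) hT _)).1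
    rw [integral_finsetSum _ hint]
  simp_rw [hpt]
  have hint2 : ∀ i ∈ (Finset.univ : Finset (Fin N)), Integrable (fun u : ℝ => ∫ z, f z *
      (∫ y, P.bondCurrent (N + 1) i.castSucc y ∂(P.transitionKernel (N + 1) T T u.toNNReal z)) ∂μ)
      (volume.restrict (Ioi 0)) := fun i _ =>
    corr_centred_integrableOn hω hl hβ hγ hT hf (pinnedChain_continuous_bondCurrent ω₂ lam β γ (N + 1) _) hfb
      (fun y => pinnedChain_abs_bondCurrent_le_exp hω.le hl hβ.le γ (N + 1) hϑ0 _ y) hf0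
  rw [integral_finsetSum _ hint2]

/-- **`∫₀^∞ ⟨θ₀, K_s J⟩ ds = N γ ∫₀^∞ C_N`**: the near-contact mixed identity summed over the `N` bonds.
[cite: KunduDharNarayan2009, arXiv:0809.4543 p. 3] -/
theorem integral_kinCorr_totalCurrent :
    ∫ u in Ioi (0 : ℝ), ∫ z, (z.2 0 ^ 2 - T) * (∫ y, (∑ i : Fin (N + 1), (pinnedChain ω₂ lam β γ).bondCurrent (N + 1) i y)
        ∂((pinnedChain ω₂ lam β γ).transitionKernel (N + 1) T T u.toNNReal z)) ∂((pinnedChain ω₂ lam β γ).gibbsMeasure (N + 1) T) =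
      (N : ℝ) * γ * ∫ u in Ioi (0 : ℝ), ∫ z, (z.2 0 ^ 2 - T) * (∫ y, (y.2 (Fin.last N) ^ 2 - T)
        ∂((pinnedChain ω₂ lam β γ).transitionKernel (N + 1) T T u.toNNReal z)) ∂((pinnedChain ω₂ lam β γ).gibbsMeasure (N + 1) T) := by
  have hϑ0 : (0 : ℝ) < 1 / (4 * T) := by positivity
  rw [integral_corr_totalCurrent_eq_sum hω hl hβ hγ hT (f := fun z : PhaseSpace (N + 1) => z.2 0 ^ 2 - T) (by fun_prop)
    (fun y => abs_sq_momentum_sub_le_exp hω hl hβ.le hϑ0 hT.le y 0) (integral_kinObs_gibbsMeasure hω hl hβ hT 0)]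
  have hterm : ∀ i : Fin N, ∫ u in Ioi (0 : ℝ), ∫ z, (z.2 0 ^ 2 - T) * (∫ y, (pinnedChain ω₂ lam β γ).bondCurrent (N + 1) i.castSucc y
      ∂((pinnedChain ω₂ lam β γ).transitionKernel (N + 1) T T u.toNNReal z)) ∂((pinnedChain ω₂ lam β γ).gibbsMeasure (N + 1) T) =
      γ * ∫ u in Ioi (0 : ℝ), ∫ z, (z.2 0 ^ 2 - T) * (∫ y, (y.2 (Fin.last N) ^ 2 - T)
        ∂((pinnedChain ω₂ lam β γ).transitionKernel (N + 1) T T u.toNNReal z)) ∂((pinnedChain ω₂ lam β γ).gibbsMeasure (N + 1) T) :=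
    fun i => integral_kinCorr_current_near hω hl hβ hγ hT (i := i.castSucc) (by rw [Fin.val_castSucc]; exact Nat.succ_lt_succ i.isLt)
  simp only [hterm, Finset.sum_const, Finset.card_univ, Fintype.card_fin, nsmul_eq_mul]
  ring

/-! ### The total current in the first slot -/

omit hω hl hβ hγ hT in
/-- `⟨J, E_{≤i}⟩_{μ₀} = 0`: the total current is odd and the block energy even under momentum reversal. [folklore] -/
theorem integral_totalCurrent_mul_leftEnergy (i : Fin (N + 1)) :
    ∫ z, (∑ k : Fin (N + 1), (pinnedChain ω₂ lam β γ).bondCurrent (N + 1) k z) * leftEnergy (pinnedChain ω₂ lam β γ) (N + 1) i z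
      ∂((pinnedChain ω₂ lam β γ).gibbsMeasure (N + 1) T) = 0 := by
  have hE : ∀ x : PhaseSpace (N + 1), leftEnergy (pinnedChain ω₂ lam β γ) (N + 1) i (x.1, -x.2) =
      leftEnergy (pinnedChain ω₂ lam β γ) (N + 1) i x := fun x => by
    unfold leftEnergy; simp
  rw [(pinnedChain ω₂ lam β γ).integral_gibbsMeasure,
    integral_mul_gibbsDensity_eq_zero_of_odd _ (N + 1) T (fun x => ?_), mul_zero]
  rw [totalBondCurrent_neg_momentum _ (N + 1), hE, neg_mul]

/-- **The mixed identity with the total current in the first slot**: for every bond `i < N`,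
`∫₀^∞ ⟨J, K_s j_i⟩ ds = -γ ∫₀^∞ ⟨J, K_s θ₀⟩ ds` (`integral_corr_current_eq` with `f = J`, centred and odd).
[cite: KunduDharNarayan2009, arXiv:0809.4543 p. 3] -/
theorem integral_totalCorr_current_eq {i : Fin (N + 1)} (hi : i.val + 1 < N + 1) :
    ∫ u in Ioi (0 : ℝ), ∫ z, (∑ k : Fin (N + 1), (pinnedChain ω₂ lam β γ).bondCurrent (N + 1) k z) *
        (∫ y, (pinnedChain ω₂ lam β γ).bondCurrent (N + 1) i y ∂((pinnedChain ω₂ lam β γ).transitionKernel (N + 1) T T u.toNNReal z))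
        ∂((pinnedChain ω₂ lam β γ).gibbsMeasure (N + 1) T) =
      -γ * ∫ u in Ioi (0 : ℝ), ∫ z, (∑ k : Fin (N + 1), (pinnedChain ω₂ lam β γ).bondCurrent (N + 1) k z) *
        (∫ y, (y.2 0 ^ 2 - T) ∂((pinnedChain ω₂ lam β γ).transitionKernel (N + 1) T T u.toNNReal z))
        ∂((pinnedChain ω₂ lam β γ).gibbsMeasure (N + 1) T) := by
  have hϑ0 : (0 : ℝ) < 1 / (4 * T) := by positivity
  obtain ⟨M, -, hM⟩ := abs_totalBondCurrent_le_exp hω.le hl hβ.le γ (N + 1) hϑ0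
  have h := integral_corr_current_eq hω hl hβ hγ hT hi (continuous_totalBondCurrent ω₂ lam β γ (N + 1)) hM
    (integral_totalBondCurrent_gibbsMeasure ω₂ lam β γ (N + 1) T)
  rw [h, integral_totalCurrent_mul_leftEnergy (ω₂ := ω₂) (lam := lam) (β := β) (γ := γ) (T := T) i]
  ring

/-- **Time reversal**: `∫₀^∞ ⟨J, K_s θ₀⟩ ds = -∫₀^∞ ⟨θ₀, K_s J⟩ ds` for `N ≥ 1` (`⟨f, K_s g⟩ = ⟨g∘Θ, K_s(f∘Θ)⟩`, `J∘Θ = -J`,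
`θ₀∘Θ = θ₀`). [cite: CuneoEckmannHairerReyBellet2018, §3.1] -/
theorem integral_totalCorr_kin_eq_neg (hN1 : 1 ≤ N) :
    ∫ u in Ioi (0 : ℝ), ∫ z, (∑ k : Fin (N + 1), (pinnedChain ω₂ lam β γ).bondCurrent (N + 1) k z) *
        (∫ y, (y.2 0 ^ 2 - T) ∂((pinnedChain ω₂ lam β γ).transitionKernel (N + 1) T T u.toNNReal z))
        ∂((pinnedChain ω₂ lam β γ).gibbsMeasure (N + 1) T) =
      -∫ u in Ioi (0 : ℝ), ∫ z, (z.2 0 ^ 2 - T) * (∫ y, (∑ i : Fin (N + 1), (pinnedChain ω₂ lam β γ).bondCurrent (N + 1) i y)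
        ∂((pinnedChain ω₂ lam β γ).transitionKernel (N + 1) T T u.toNNReal z)) ∂((pinnedChain ω₂ lam β γ).gibbsMeasure (N + 1) T) := by
  have hn2 : 2 ≤ N + 1 := by omega
  have hϑ0 : (0 : ℝ) < 1 / (8 * T) := by positivity
  have h2ϑ : 2 * (1 / (8 * T)) < 1 / T := by
    rw [show 2 * (1 / (8 * T)) = 1 / (4 * T) by field_simp; ring, div_lt_div_iff₀ (by positivity) hT]; nlinarith
  obtain ⟨M, hM0, hM⟩ := abs_totalBondCurrent_le_exp hω.le hl hβ.le γ (N + 1) hϑ0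
  have hC : (0 : ℝ) ≤ 2 / (1 / (8 * T)) + T := by positivity
  rw [← integral_neg]
  refine setIntegral_congr_fun measurableSet_Ioi fun u hu => ?_
  have h := pinnedChain_integral_mul_act_flip hω hl hβ hγ hn2 hT hϑ0 h2ϑ
    (f := fun z : PhaseSpace (N + 1) => ∑ k : Fin (N + 1), (pinnedChain ω₂ lam β γ).bondCurrent (N + 1) k z)
    (g := fun z : PhaseSpace (N + 1) => z.2 0 ^ 2 - T)
    (continuous_totalBondCurrent ω₂ lam β γ (N + 1)) (by fun_prop) hM0 hC hM
    (fun y => abs_sq_momentum_sub_le_exp hω hl hβ.le hϑ0 hT.le y 0) (le_of_lt hu)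
  simp only at h
  rw [h]
  have hflip : ∀ z : PhaseSpace (N + 1), (∫ y, (∑ k : Fin (N + 1), (pinnedChain ω₂ lam β γ).bondCurrent (N + 1) k (y.1, -y.2))
      ∂((pinnedChain ω₂ lam β γ).transitionKernel (N + 1) T T u.toNNReal z)) =
      -∫ y, (∑ k : Fin (N + 1), (pinnedChain ω₂ lam β γ).bondCurrent (N + 1) k y)
        ∂((pinnedChain ω₂ lam β γ).transitionKernel (N + 1) T T u.toNNReal z) := by
    intro z
    rw [← integral_neg]
    refine integral_congr_ae (Eventually.of_forall fun y => ?_)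
    exact totalBondCurrent_neg_momentum _ (N + 1) y
  simp_rw [hflip]
  rw [← integral_neg]
  refine integral_congr_ae (Eventually.of_forall fun z => ?_)
  simp only [Pi.neg_apply, even_two.neg_pow]
  ring

/-- **THE CURRENT–CURRENT GREEN–KUBO FORM OF THE CROSS KERNEL.** For every `N ≥ 1`:

  `∫₀^∞ ∫ J · K_s J dμ₀ ds = γ² N² ∫₀^∞ C_N`,   `J = Σ_i j_i`, `C_N(s) = ∫ (p₀² - T) K_s(p_N² - T) dμ₀`

— the equilibrium current–current Green–Kubo integral of the open chain IS the cross-form boundary Kubo value, at the level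
of the constructed kernels (Kundu–Dhar–Narayan's `(k_B T²)⁻¹∫⟨j̄ j̄⟩` with `j̄ = J/N` equals `(γ²/T²)∫C_N`); no steady state,
no linear response. Proof: linearity in the current slot, `∫₀^∞⟨J, K_s j_i⟩ = -γ∫₀^∞⟨J, K_sθ₀⟩ = γ∫₀^∞⟨θ₀, K_s J⟩ = γ² N ∫₀^∞ C_N`
for each of the `N` bonds. [cite: KunduDharNarayan2009, arXiv:0809.4543 p. 3] -/
theorem integral_totalCorr_totalCurrent (hN1 : 1 ≤ N) :
    ∫ u in Ioi (0 : ℝ), ∫ z, (∑ k : Fin (N + 1), (pinnedChain ω₂ lam β γ).bondCurrent (N + 1) k z) *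
        (∫ y, (∑ i : Fin (N + 1), (pinnedChain ω₂ lam β γ).bondCurrent (N + 1) i y)
          ∂((pinnedChain ω₂ lam β γ).transitionKernel (N + 1) T T u.toNNReal z)) ∂((pinnedChain ω₂ lam β γ).gibbsMeasure (N + 1) T) =
      γ ^ 2 * (N : ℝ) ^ 2 * ∫ u in Ioi (0 : ℝ), ∫ z, (z.2 0 ^ 2 - T) * (∫ y, (y.2 (Fin.last N) ^ 2 - T)
        ∂((pinnedChain ω₂ lam β γ).transitionKernel (N + 1) T T u.toNNReal z)) ∂((pinnedChain ω₂ lam β γ).gibbsMeasure (N + 1) T) := by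
  have hϑ0 : (0 : ℝ) < 1 / (4 * T) := by positivity
  obtain ⟨M, -, hM⟩ := abs_totalBondCurrent_le_exp hω.le hl hβ.le γ (N + 1) hϑ0
  rw [integral_corr_totalCurrent_eq_sum hω hl hβ hγ hT (continuous_totalBondCurrent ω₂ lam β γ (N + 1)) hM
    (integral_totalBondCurrent_gibbsMeasure ω₂ lam β γ (N + 1) T)]
  have hterm : ∀ i : Fin N, ∫ u in Ioi (0 : ℝ), ∫ z, (∑ k : Fin (N + 1), (pinnedChain ω₂ lam β γ).bondCurrent (N + 1) k z) *
      (∫ y, (pinnedChain ω₂ lam β γ).bondCurrent (N + 1) i.castSucc y ∂((pinnedChain ω₂ lam β γ).transitionKernel (N + 1) T T u.toNNReal z))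
      ∂((pinnedChain ω₂ lam β γ).gibbsMeasure (N + 1) T) =
      γ ^ 2 * (N : ℝ) * ∫ u in Ioi (0 : ℝ), ∫ z, (z.2 0 ^ 2 - T) * (∫ y, (y.2 (Fin.last N) ^ 2 - T)
        ∂((pinnedChain ω₂ lam β γ).transitionKernel (N + 1) T T u.toNNReal z)) ∂((pinnedChain ω₂ lam β γ).gibbsMeasure (N + 1) T) := by
    intro i
    rw [integral_totalCorr_current_eq hω hl hβ hγ hT (i := i.castSucc) (by rw [Fin.val_castSucc]; exact Nat.succ_lt_succ i.isLt),
      integral_totalCorr_kin_eq_neg hω hl hβ hγ hT hN1, integral_kinCorr_totalCurrent hω hl hβ hγ hT]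
    ring
  simp only [hterm, Finset.sum_const, Finset.card_univ, Fintype.card_fin, nsmul_eq_mul]
  ring

/-! ### Positivity of the conductance and the two-sided `N`-uniform bounds -/

/-- **`∫₀^∞ C_N ≥ 0` (kinetic-kernel form) for every `N ≥ 1`**: Green–Kubo positivity for the centred nice observable `J`
(`greenKubo_autocorr_nonneg`) and `∫₀^∞⟨J, K_s J⟩ = γ²N²∫₀^∞ C_N`. [cite: KunduDharNarayan2009, arXiv:0809.4543 p. 3] -/
theorem integral_kinCorr_cross_nonneg (hN1 : 1 ≤ N) :
    0 ≤ ∫ u in Ioi (0 : ℝ), ∫ z, (z.2 0 ^ 2 - T) * (∫ y, (y.2 (Fin.last N) ^ 2 - T)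
        ∂((pinnedChain ω₂ lam β γ).transitionKernel (N + 1) T T u.toNNReal z)) ∂((pinnedChain ω₂ lam β γ).gibbsMeasure (N + 1) T) := by
  have hϑ0 : (0 : ℝ) < 1 / (8 * T) := by positivity
  have h2ϑ : 2 * (1 / (8 * T)) < 1 / T := by
    rw [show 2 * (1 / (8 * T)) = 1 / (4 * T) by field_simp; ring, div_lt_div_iff₀ (by positivity) hT]; nlinarith
  obtain ⟨M, hM0, hM⟩ := abs_totalBondCurrent_le_exp hω.le hl hβ.le γ (N + 1) hϑ0
  have hpos := greenKubo_autocorr_nonneg hω hl hβ hγ (Nat.succ_pos N) hT hϑ0 h2ϑ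
    (continuous_totalBondCurrent ω₂ lam β γ (N + 1)) hM0 hM (integral_totalBondCurrent_gibbsMeasure ω₂ lam β γ (N + 1) T)
  rw [integral_totalCorr_totalCurrent hω hl hβ hγ hT hN1] at hpos
  have hc : 0 < γ ^ 2 * (N : ℝ) ^ 2 := by
    have : (1 : ℝ) ≤ N := by exact_mod_cast hN1
    positivity
  exact nonneg_of_mul_nonneg_right hpos hc

/-- **`∫₀^∞ C_N ≥ 0` for EVERY `N`** (item's power covariance; `N = 0`: `C_0 = A_0 ≥ 0` by Green–Kubo positivity of the
kinetic autocorrelation). [cite: KunduDharNarayan2009, arXiv:0809.4543 p. 3] -/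
theorem integral_CN_nonneg (N : ℕ) :
    0 ≤ ∫ t in Ioi (0 : ℝ), ((∫ z, (z.2 0) ^ 2 * (∫ y, (y.2 (Fin.last N)) ^ 2 ∂((pinnedChain ω₂ lam β γ).transitionKernel (N + 1) T T t.toNNReal z)) ∂((pinnedChain ω₂ lam β γ).gibbsMeasure (N + 1) T)) - (∫ z, (z.2 0) ^ 2 ∂((pinnedChain ω₂ lam β γ).gibbsMeasure (N + 1) T)) * (∫ z, (∫ y, (y.2 (Fin.last N)) ^ 2 ∂((pinnedChain ω₂ lam β γ).transitionKernel (N + 1) T T t.toNNReal z)) ∂((pinnedChain ω₂ lam β γ).gibbsMeasure (N + 1) T))) := by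
  have hC : (fun t : ℝ => ((∫ z, (z.2 0) ^ 2 * (∫ y, (y.2 (Fin.last N)) ^ 2 ∂((pinnedChain ω₂ lam β γ).transitionKernel (N + 1) T T t.toNNReal z)) ∂((pinnedChain ω₂ lam β γ).gibbsMeasure (N + 1) T)) - (∫ z, (z.2 0) ^ 2 ∂((pinnedChain ω₂ lam β γ).gibbsMeasure (N + 1) T)) * (∫ z, (∫ y, (y.2 (Fin.last N)) ^ 2 ∂((pinnedChain ω₂ lam β γ).transitionKernel (N + 1) T T t.toNNReal z)) ∂((pinnedChain ω₂ lam β γ).gibbsMeasure (N + 1) T)))) =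
      fun t : ℝ => ∫ z, (z.2 0 ^ 2 - T) * (∫ y, (y.2 (Fin.last N) ^ 2 - T)
        ∂((pinnedChain ω₂ lam β γ).transitionKernel (N + 1) T T t.toNNReal z)) ∂((pinnedChain ω₂ lam β γ).gibbsMeasure (N + 1) T) :=
    funext fun t => CN_eq_kinCorr hω hl hβ hγ hT N t
  rw [hC]
  rcases Nat.eq_zero_or_pos N with hN0 | hNpos
  · subst hN0
    have hl0 : (Fin.last 0 : Fin (0 + 1)) = 0 := rfl
    rw [hl0]
    exact integral_kinCorr_self_nonneg hω hl hβ hγ (Nat.succ_pos 0) hT 0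
  · exact integral_kinCorr_cross_nonneg hω hl hβ hγ hT hNpos

/-- **THE CONDUCTANCE IS NON-NEGATIVE, uniformly in `N`**: `0 ≤ (γ²/T²) ∫₀^∞ C_N` for every `N`; together with
`conductance_le_half` the equilibrium Green–Kubo conductance of the `(N+1)`-site anharmonic chain lies in `[0, γ/2]` for all
lengths and all parameters. [cite: KunduDharNarayan2009, arXiv:0809.4543 p. 3] -/
theorem conductance_nonneg (N : ℕ) :
    0 ≤ (γ ^ 2 / T ^ 2) * ∫ t in Ioi (0 : ℝ), ((∫ z, (z.2 0) ^ 2 * (∫ y, (y.2 (Fin.last N)) ^ 2 ∂((pinnedChain ω₂ lam β γ).transitionKernel (N + 1) T T t.toNNReal z)) ∂((pinnedChain ω₂ lam β γ).gibbsMeasure (N + 1) T)) - (∫ z, (z.2 0) ^ 2 ∂((pinnedChain ω₂ lam β γ).gibbsMeasure (N + 1) T)) * (∫ z, (∫ y, (y.2 (Fin.last N)) ^ 2 ∂((pinnedChain ω₂ lam β γ).transitionKernel (N + 1) T T t.toNNReal z)) ∂((pinnedChain ω₂ lam β γ).gibbsMeasure (N + 1) T))) :=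
  mul_nonneg (by positivity) (integral_CN_nonneg hω hl hβ hγ hT N)

/-- **`a_N ≥ -γ N` for every `N`**: `a_N = N(γ²/T²)∫C_N - 2(γ²/T²)·N∫r_N²` (`seq_eq_sub`), the first term is `≥ 0`
(`conductance_nonneg`) and the coherent channel is `≤ γN` (`coherent_term_le_linear`). [cite: KunduDharNarayan2009, arXiv:0809.4543 p. 3] -/
theorem seq_ge_neg_linear (N : ℕ) :
    -(γ * N) ≤ (N : ℝ) * (γ ^ 2 / T ^ 2) * ∫ t in Set.Ioi (0 : ℝ), (((∫ z, (z.2 0) ^ 2 * (∫ y, (y.2 (Fin.last N)) ^ 2 ∂((pinnedChain ω₂ lam β γ).transitionKernel (N + 1) T T t.toNNReal z)) ∂((pinnedChain ω₂ lam β γ).gibbsMeasure (N + 1) T)) - (∫ z, (z.2 0) ^ 2 ∂((pinnedChain ω₂ lam β γ).gibbsMeasure (N + 1) T)) * (∫ z, (∫ y, (y.2 (Fin.last N)) ^ 2 ∂((pinnedChain ω₂ lam β γ).transitionKernel (N + 1) T T t.toNNReal z)) ∂((pinnedChain ω₂ lam β γ).gibbsMeasure (N + 1) T))) - 2 * (∫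 z, z.2 0 * (∫ y, y.2 (Fin.last N) ∂((pinnedChain ω₂ lam β γ).transitionKernel (N + 1) T T t.toNNReal z)) ∂((pinnedChain ω₂ lam β γ).gibbsMeasure (N + 1) T)) ^ 2) := by
  rw [seq_eq_sub hω hl hβ hγ hT N]
  have h1 := conductance_nonneg hω hl hβ hγ hT N
  have h2 := coherent_term_le_linear hω hl hβ hγ hT N
  have hN0 : (0 : ℝ) ≤ N := Nat.cast_nonneg N
  have h3 : 0 ≤ (N : ℝ) * ((γ ^ 2 / T ^ 2) * ∫ t in Ioi (0 : ℝ), ((∫ z, (z.2 0) ^ 2 * (∫ y, (y.2 (Fin.last N)) ^ 2 ∂((pinnedChain ω₂ lam β γ).transitionKernel (N + 1) T T t.toNNReal z)) ∂((pinnedChain ω₂ lam β γ).gibbsMeasure (N + 1) T)) - (∫ z, (z.2 0) ^ 2 ∂((pinnedChain ω₂ lam β γ).gibbsMeasure (N + 1) T)) * (∫ z, (∫ y, (y.2 (Fin.last N)) ^ 2 ∂((pinnedChain ω₂ lam β γ).transitionKernel (N + 1) T T t.toNNReal z)) ∂((pinnedChain ω₂ lam β γ).gibbsMeasure (N + 1)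 T)))) :=
    mul_nonneg hN0 h1
  nlinarith [h2, h3]

/-- **`|a_N| ≤ γ N` for every `N`** — the two-sided `N`-uniform (linear) bound on the item's sequence
(`seq_le_half_linear`, `seq_ge_neg_linear`); the item `IncoherentBounded` asks for `O(1)`.
[cite: KunduDharNarayan2009, arXiv:0809.4543 p. 3] -/
theorem abs_seq_le_linear (N : ℕ) :
    |(N : ℝ) * (γ ^ 2 / T ^ 2) * ∫ t in Set.Ioi (0 : ℝ), (((∫ z, (z.2 0) ^ 2 * (∫ y, (y.2 (Fin.last N)) ^ 2 ∂((pinnedChain ω₂ lam β γ).transitionKernel (N + 1) T T t.toNNReal z)) ∂((pinnedChain ω₂ lam β γ).gibbsMeasure (N + 1) T)) - (∫ z, (z.2 0) ^ 2 ∂((pinnedChain ω₂ lam β γ).gibbsMeasure (N + 1) T)) * (∫ z, (∫ y, (y.2 (Fin.last N)) ^ 2 ∂((pinnedChain ω₂ lam β γ).transitionKernel (N + 1) T T t.toNNReal z)) ∂((pinnedChain ω₂ lam β γ).gibbsMeasure (N + 1) T))) - 2 * (∫ z, z.2 0 * (∫ y, y.2 (Fin.last N) ∂((pinnedChain ω₂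 lam β γ).transitionKernel (N + 1) T T t.toNNReal z)) ∂((pinnedChain ω₂ lam β γ).gibbsMeasure (N + 1) T)) ^ 2)| ≤
      γ * N := by
  rw [abs_le]
  constructor
  · exact seq_ge_neg_linear hω hl hβ hγ hT N
  · have h := seq_le_half_linear hω hl hβ hγ hT N
    have : γ * (N : ℝ) / 2 ≤ γ * N := by
      have : 0 ≤ γ * (N : ℝ) := by positivity
      linarith
    linarith

end Current

end Summit.AtomisticToContinuum.FouriersLaw.Theorems.IncoherentBounded

end
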